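import Summits.BirchSwinnertonDyer.Rank1Residual.X11b.Three.GoodReductionSubgroupCuspPresentation
import Summits.BirchSwinnertonDyer.Rank1Residual.X11b.Three.GoodReductionSubgroupMultiplicativeH1
import HarnessLib

/-!
# X11b at `p = 3` (team N8/O2), JET3-KUMMER (α) at an ADDITIVE prime of `E/ℚ` and at EVERY BAD
# place in one call: the `ℚ_ℓ` dictionary for additive reduction, and the trichotomy glue
# (multiplicative: p3's `GoodReductionSubgroupMultiplicativeH1`; additive: part 14)

HONEST FRAMING (cell `b2b-bsdres`, run/shared/lean/b2b/bsd-rank1-residual/, verbatim in every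
file): the goal of the cell is to DELETE the COMBINATION-SHAPED residual classes of the
Birch–Swinnerton-Dyer formula for ALL analytic-rank `≤ 1` elliptic curves over `ℚ` — "full BSD
formula for every rank `≤ 1` curve in class `C`" assembled STRICTLY from published theorems — so
that the rank-`≤ 1` remainder becomes exactly the CONSTRUCTION-SHAPED classes, which are TYPED
(missing-input `Prop`s), NOT attempted. This is not "finishing BSD". Team N8/O2 = `x11b3`, seat
`b2b-bsdres-x11b3-p4` (provider of record at additive places, LEAD DEAL #7 R7-28 / R7-35), S15 (v)
part 15. THEOREMS ONLY: no definition, no named fact, no `sorry`; nothing is booked; `JET@p|N` NOT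
discharged.

## What

* §1 **`hasAdditiveReduction_baseChange_padic_of_not_good_of_not_mult`**: for `W/ℚ` elliptic and
  globally minimal, if `W` has neither good nor multiplicative reduction at `p` (the tree's class
  predicates `HasGoodReductionAtPrime` / `HasMultiplicativeReductionAtPrime`, i.e. the Mathlib
  classes of the chosen `ℤ_p`-minimal model), then `W ⊗ ℚ_p` itself (`ℤ_p`-minimal: p1's
  `isMinimal_baseChange_padic`) has ADDITIVE reduction over `ℤ_[p]` — Mathlib's trichotomy on the
  minimal model transported by the tree's `hasAdditiveReduction_iff_of_isMinimal_of_eq_smul`;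
  `…_padic_self` for `(W ⊗ ℚ_p) ⊗ ℚ_p`.
* §2 **`hasAdditiveReduction_baseChange_padic_of_isMinimal`**: over a layer `L ⊇ ℚ_p` with
  valuation ring `R`, `ℤ_p → R` local, GIVEN `[((W ⊗ ℚ_p) ⊗ L).IsMinimal R]` (residual input R7′ —
  minimality of the `ℚ_p`-minimal equation over the unramified layer at an additive prime; Tate's
  algorithm under unramified base change, NOT in the tree), `(W ⊗ ℚ_p) ⊗ L` is additive over `R`.
* §3 `hα_padic_of_not_good_of_not_mult_of_adicComplete`,
  **`exists_baseChange_eq_add_pow_smul_padic_of_not_good_of_not_mult`**: (α) and Jetchev's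
  Prop. 4.1 at `v ∣ ℓ` for `E/ℚ` ADDITIVE at `ℓ`, NO stub (part 14 + §2).
* §4 **`hα_of_not_hasGoodReduction_of_adicComplete`** (abstract layer `L/F`) — (α) at EVERY BAD
  place in ONE call: under `[(X.baseChange L).IsMinimal R]` and `¬ HasGoodReduction R`, Mathlib's
  trichotomy gives multiplicative (⇒ p3's `hα_of_hasMultiplicativeReduction_of_adicComplete`,
  p256790) or additive (⇒ part 14's `hα_of_hasAdditiveReduction_of_adicComplete`); both branches
  have the SAME residual binders R1–R8, so the case split is invisible to (iv). With
  `exists_baseChange_eq_add_pow_smul_of_not_hasGoodReduction_of_adicComplete`.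
* §5 `hα_padic_of_not_hasGoodReductionAtPrime_of_adicComplete`,
  **`exists_baseChange_eq_add_pow_smul_padic_of_not_hasGoodReductionAtPrime`**: the same for `E/ℚ`
  at any BAD prime (`¬ W.HasGoodReductionAtPrime p`): `by_cases` multiplicative (p3's padic form)
  / additive (§3).

RESIDUAL BINDERS (`S15-INTERFACE.md` §4): R1 `hR`, R2 `[IsAdicComplete 𝔪 R]`, R3 `[Finite k]` +
`hcard`, R4 `φ`/`hφ`/`hn`/`hfrob`, R5 `hϖ`/`hπ`, R6 `[IsGalois]` (end forms), R8 `W₀`/`hX`, and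
R7/R7′ `[(… ⊗ L).IsMinimal R]` (a theorem at multiplicative places — p4's
`isMinimal_baseChange_of_hasMultiplicativeReduction` — and a LABELLED residual at additive ones).

References (locators only; no new fact): [cite: SilvermanAEC2009, VII.1 Prop. 1.3(b), VII.5
Prop. 5.1 and Prop. 5.4 (PDF pp. 165, 174–175), VIII.8] [cite: Jetchev2008, Prop. 4.1 (p. 819)]
[cite: MilneADT2006, Ch. I Prop. 3.8] [cite: GrossLMS1991, Prop. 6.2 (1), pp. 244–245].

## Design

No definitions; `noncomputable section`; `open scoped Classical`; `L : Type` in the `ℚ_[p]`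
sections (the universe of `ℚ_[p]`), universe `u` in §4. Axioms: `propext`, `Classical.choice`,
`Quot.sound`.
-/

noncomputable section

open scoped Classical

namespace Summit.BirchSwinnertonDyer.Rank1Residual.X11b.Three.JetchevKummer

open WeierstrassCurve Literature.NumberTheory.EllipticCurves

universe u

/-! ### §1 Additive reduction at `p`, read on the global minimal equation `W ⊗ ℚ_p` -/

section PadicSelf

variable (W : WeierstrassCurve ℚ) [W.IsElliptic] [W.IsGloballyMinimal] (p : ℕ) [Fact p.Prime]

/-- **Additive reduction at `p` from the class predicates.** For a global minimal `W/ℚ`: if the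
chosen `ℤ_p`-minimal model of `W ⊗ ℚ_p` has neither good nor multiplicative reduction (the tree's
`HasGoodReductionAtPrime` / `HasMultiplicativeReductionAtPrime` negated), then `W ⊗ ℚ_p` itself has
ADDITIVE reduction over `ℤ_[p]` (Mathlib's trichotomy for minimal equations; two minimal equations
differ by a change of variables with `v(u) = 0`).
[cite: SilvermanAEC2009, VII.1 Prop. 1.3(b) and VII.5 Prop. 5.1 (PDF pp. 165, 174)] -/
theorem hasAdditiveReduction_baseChange_padic_of_not_good_of_not_mult
    (hg : ¬ W.HasGoodReductionAtPrime p) (hm : ¬ W.HasMultiplicativeReductionAtPrime p) :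
    (W.baseChange ℚ_[p]).HasAdditiveReduction ℤ_[p] := by
  have hadd : ((W.baseChange ℚ_[p]).minimal ℤ_[p]).HasAdditiveReduction ℤ_[p] := by
    rcases hasGoodReduction_or_hasMultiplicativeReduction_or_hasAdditiveReduction ℤ_[p]
      (W := (W.baseChange ℚ_[p]).minimal ℤ_[p]) with h | h | h
    · exact absurd h hg
    · exact absurd h hm
    · exact h
  exact (hasAdditiveReduction_iff_of_isMinimal_of_eq_smul ℤ_[p]
    (W₂ := (W.baseChange ℚ_[p]).minimal ℤ_[p]) (W₁ := W.baseChange ℚ_[p])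
    (D := ((W.baseChange ℚ_[p]).exists_isMinimal ℤ_[p]).choose) rfl
    (W.baseChange ℚ_[p]).isUnit_Δ.ne_zero).mp hadd

/-- The same in the dictionary's spelling over `R₀ = ℤ_[p]`: `(W ⊗ ℚ_p) ⊗ ℚ_p` has additive
reduction over `ℤ_[p]`. [folklore] -/
theorem hasAdditiveReduction_baseChange_padic_self
    (hg : ¬ W.HasGoodReductionAtPrime p) (hm : ¬ W.HasMultiplicativeReductionAtPrime p) :
    ((W.baseChange ℚ_[p]).baseChange ℚ_[p]).HasAdditiveReduction ℤ_[p] := by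
  rw [baseChange_padic_baseChange_self]
  exact hasAdditiveReduction_baseChange_padic_of_not_good_of_not_mult W p hg hm

end PadicSelf

/-! ### §2–§3 Over a layer `L ⊇ ℚ_p` with valuation ring `R`, `ℤ_p → R` local -/

section PadicLayer

variable (W : WeierstrassCurve ℚ) [W.IsElliptic] [W.IsGloballyMinimal] (p : ℕ) [Fact p.Prime]
  (L : Type) [Field L] [Algebra ℚ_[p] L]
  (R : Type*) [CommRing R] [IsDomain R] [IsDiscreteValuationRing R] [Algebra R L]
  [IsFractionRing R L] [Algebra ℤ_[p] R] [Algebra ℤ_[p] L] [IsScalarTower ℤ_[p] R L]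
  [IsScalarTower ℤ_[p] ℚ_[p] L] [IsLocalHom (algebraMap ℤ_[p] R)]

/-- **Additive reduction at `p` over every layer `L ⊇ ℚ_p` with `ℤ_p → R` local, GIVEN that the
`ℚ_p`-minimal equation stays `R`-minimal** (residual input R7′ — at an additive prime the tree
does not prove minimality under unramified base change): `(W ⊗ ℚ_p) ⊗ L` has additive reduction
over `R`. [cite: SilvermanAEC2009, Prop. VII.5.4 (PDF p. 175)] -/
theorem hasAdditiveReduction_baseChange_padic_of_isMinimal
    [((W.baseChange ℚ_[p]).baseChange L).IsMinimal R]
    (hg : ¬ W.HasGoodReductionAtPrime p) (hm : ¬ W.HasMultiplicativeReductionAtPrime p) :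
    ((W.baseChange ℚ_[p]).baseChange L).HasAdditiveReduction R := by
  haveI := hasAdditiveReduction_baseChange_padic_self W p hg hm
  exact hasAdditiveReduction_baseChange_of_isMinimal (W.baseChange ℚ_[p]) L ℤ_[p] R

/-- **(α) for `E/ℚ` at an ADDITIVE prime `p`, over a complete unramified layer `L ⊇ ℚ_p`** (finite
residue field of `qⁿ` elements, `Aut(L/ℚ_p) = ⟨φ⟩`, `φⁿ = 1`, `φ` lifting `x ↦ x^q`, every `τ`
preserving `R`, a uniformiser of `R` from `ℚ_p`), GIVEN the minimality of `(W ⊗ ℚ_p) ⊗ L` over `R`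
(R7′): p1's hypothesis `hα` of `JetchevKummerAtP` is a theorem — no stub (parts 11–14 + §2).
[cite: MilneADT2006, Ch. I Prop. 3.8] [cite: SilvermanAEC2009, VII.2 Prop. 2.1, Prop. III.2.5(b)] -/
theorem hα_padic_of_not_good_of_not_mult_of_adicComplete
    [IsAdicComplete (IsLocalRing.maximalIdeal R) R] [Finite (IsLocalRing.ResidueField R)]
    [((W.baseChange ℚ_[p]).baseChange L).IsMinimal R]
    (hg : ¬ W.HasGoodReductionAtPrime p) (hm : ¬ W.HasMultiplicativeReductionAtPrime p)
    (W₀ : WeierstrassCurve R) (hX : (W.baseChange ℚ_[p]).baseChange L = W₀.baseChange L)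
    (hR : ∀ (τ : L ≃ₐ[ℚ_[p]] L) (x : L), x ∈ Set.range (algebraMap R L) →
      τ x ∈ Set.range (algebraMap R L))
    (φ : L ≃ₐ[ℚ_[p]] L) (hφ : ∀ σ : L ≃ₐ[ℚ_[p]] L, σ ∈ Subgroup.zpowers φ) {q n : ℕ}
    (hn : φ ^ n = 1) (hcard : Nat.card (IsLocalRing.ResidueField R) = q ^ n)
    (hfrob : ∀ a : R, ∃ a' : R, algebraMap R L a' = φ (algebraMap R L a) ∧
      IsLocalRing.residue R a' = IsLocalRing.residue R a ^ q)
    {ϖ : R} (hϖ : Irreducible ϖ) {π : ℚ_[p]} (hπ : algebraMap ℚ_[p] L π = algebraMap R L ϖ) :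
    ∀ Q : ((W.baseChange ℚ_[p]).baseChange L).toAffine.Point,
      (∀ σ : L ≃ₐ[ℚ_[p]] L,
          σ • Q - Q ∈ ((W.baseChange ℚ_[p]).baseChange L).goodReductionSubgroup R) →
        ∃ Q' : ((W.baseChange ℚ_[p]).baseChange L).toAffine.Point,
          (∀ σ : L ≃ₐ[ℚ_[p]] L, σ • Q' = Q') ∧
            Q - Q' ∈ ((W.baseChange ℚ_[p]).baseChange L).goodReductionSubgroup R := by
  haveI := hasAdditiveReduction_baseChange_padic_of_isMinimal W p L R hg hm
  exact hα_of_hasAdditiveReduction_of_adicComplete (W.baseChange ℚ_[p]) L R W₀ hX hR φ hφ hn hcard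
    hfrob hϖ hπ

/-- **Jetchev's Prop. 4.1 at `v ∣ ℓ`, end form, NO stub, for `E/ℚ` with ADDITIVE reduction at
`ℓ` (`= p` here)**, over a Galois layer `L ⊇ ℚ_p` with complete valuation ring `R` (`ℤ_p → R`
local, finite residue field of `qⁿ` elements, `Aut(L/ℚ_p) = ⟨φ⟩`, `φⁿ = 1`, `φ` lifting
`x ↦ x^q`, every `τ` preserving `R`, a uniformiser of `R` from `ℚ_p`), GIVEN the minimality of
`(W ⊗ ℚ_p) ⊗ L` over `R` (R7′; plus, to STATE `E₀(ℚ_p)`, `[((W ⊗ ℚ_p) ⊗ ℚ_p).IsMinimal ℤ_p]` =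
p8's `isMinimal_baseChange_padic_self`) and p1's inputs (a) `hT`, (b) `hP`/`hRσ`, the cocycle
`hU`/`hpU`: `T = ι(t₀ + p^m t₁)` with `t₀ ∈ E₀(ℚ_p)`. The flag `JET@p|N` is NOT discharged.
[cite: Jetchev2008, Prop. 4.1 (p. 819)] [cite: MilneADT2006, Ch. I Prop. 3.8] -/
theorem exists_baseChange_eq_add_pow_smul_padic_of_not_good_of_not_mult [IsGalois ℚ_[p] L]
    [IsAdicComplete (IsLocalRing.maximalIdeal R) R] [Finite (IsLocalRing.ResidueField R)]
    [((W.baseChange ℚ_[p]).baseChange L).IsMinimal R]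
    [((W.baseChange ℚ_[p]).baseChange ℚ_[p]).IsMinimal ℤ_[p]]
    (hg : ¬ W.HasGoodReductionAtPrime p) (hm : ¬ W.HasMultiplicativeReductionAtPrime p)
    (W₀ : WeierstrassCurve R) (hX : (W.baseChange ℚ_[p]).baseChange L = W₀.baseChange L)
    (hR : ∀ (τ : L ≃ₐ[ℚ_[p]] L) (x : L), x ∈ Set.range (algebraMap R L) →
      τ x ∈ Set.range (algebraMap R L))
    (φ : L ≃ₐ[ℚ_[p]] L) (hφ : ∀ σ : L ≃ₐ[ℚ_[p]] L, σ ∈ Subgroup.zpowers φ) {q n : ℕ}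
    (hn : φ ^ n = 1) (hcard : Nat.card (IsLocalRing.ResidueField R) = q ^ n)
    (hfrob : ∀ a : R, ∃ a' : R, algebraMap R L a' = φ (algebraMap R L a) ∧
      IsLocalRing.residue R a' = IsLocalRing.residue R a ^ q)
    {ϖ : R} (hϖ : Irreducible ϖ) {π : ℚ_[p]} (hπ : algebraMap ℚ_[p] L π = algebraMap R L ϖ)
    {m n' : ℕ} (hcop : Nat.Coprime n' (p ^ m))
    {U P T : ((W.baseChange ℚ_[p]).baseChange L).toAffine.Point}
    {Rσ : (L ≃ₐ[ℚ_[p]] L) → ((W.baseChange ℚ_[p]).baseChange L).toAffine.Point}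
    (hT : ∀ σ : L ≃ₐ[ℚ_[p]] L, σ • T = T)
    (hP : (n' : ℤ) • P ∈ ((W.baseChange ℚ_[p]).baseChange L).goodReductionSubgroup R)
    (hRσ : ∀ σ : L ≃ₐ[ℚ_[p]] L,
      (n' : ℤ) • Rσ σ ∈ ((W.baseChange ℚ_[p]).baseChange L).goodReductionSubgroup R)
    (hU : ∀ σ : L ≃ₐ[ℚ_[p]] L, σ • U - U = Rσ σ) (hpU : ((p ^ m : ℕ) : ℤ) • U = P - T) :
    ∃ t₀ t₁ : ((W.baseChange ℚ_[p]).baseChange ℚ_[p]).toAffine.Point,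
      t₀ ∈ ((W.baseChange ℚ_[p]).baseChange ℚ_[p]).goodReductionSubgroup ℤ_[p] ∧
      T = Affine.Point.baseChange (W' := (W.baseChange ℚ_[p]).toAffine) ℚ_[p] L
        (t₀ + ((p ^ m : ℕ) : ℤ) • t₁) := by
  haveI := hasAdditiveReduction_baseChange_padic_of_isMinimal W p L R hg hm
  exact exists_baseChange_eq_add_pow_smul_of_hasAdditiveReduction_of_adicComplete
    (W.baseChange ℚ_[p]) L R W₀ hX ℤ_[p] hR φ hφ hn hcard hfrob hϖ hπ hcop hT hP hRσ hU hpU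

end PadicLayer

/-! ### §4 (α) at EVERY BAD place of an abstract layer `L/F`, in one call -/

section Bad

variable {F : Type u} [Field F] (X : WeierstrassCurve F) (L : Type u) [Field L] [Algebra F L]
  (R : Type*) [CommRing R] [IsDomain R] [IsDiscreteValuationRing R] [Algebra R L]
  [IsFractionRing R L] [IsAdicComplete (IsLocalRing.maximalIdeal R) R]
  [Finite (IsLocalRing.ResidueField R)] [(X.baseChange L).IsElliptic] [(X.baseChange L).IsMinimal R]
  (W₀ : WeierstrassCurve R) (hX : X.baseChange L = W₀.baseChange L)

include hX in
/-- **(α) at EVERY BAD place of the layer, multiplicative OR additive, in one call.** For `R` a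
complete DVR of `L` with finite residue field, the `R`-minimal `X ⊗ L` with BAD reduction
(`¬ HasGoodReduction R`), all of `Aut(L/F)` preserving `R`, `Aut(L/F) = ⟨φ⟩` with `φⁿ = 1`,
`#k = qⁿ`, `φ ≡ (x ↦ x^q)` on `k`, a uniformiser of `R` from `F`: p1's hypothesis `hα` of
`JetchevKummerAtP` holds. Mathlib's trichotomy; multiplicative branch = p3's
`hα_of_hasMultiplicativeReduction_of_adicComplete` (p256790: split/non-split glued), additive
branch = part 14's `hα_of_hasAdditiveReduction_of_adicComplete`. Milne, *ADT* I Prop. 3.8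
(`H¹(k_w/k_v, 𝒜°) = 0`, any reduction type). [cite: MilneADT2006, Ch. I Prop. 3.8]
[cite: SilvermanAEC2009, VII.2 Prop. 2.1, Prop. III.2.5, VII.§5] -/
theorem hα_of_not_hasGoodReduction_of_adicComplete (hbad : ¬ (X.baseChange L).HasGoodReduction R)
    (hR : ∀ (τ : L ≃ₐ[F] L) (x : L), x ∈ Set.range (algebraMap R L) →
      τ x ∈ Set.range (algebraMap R L))
    (φ : L ≃ₐ[F] L) (hφ : ∀ σ : L ≃ₐ[F] L, σ ∈ Subgroup.zpowers φ) {q n : ℕ} (hn : φ ^ n = 1)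
    (hcard : Nat.card (IsLocalRing.ResidueField R) = q ^ n)
    (hfrob : ∀ a : R, ∃ a' : R, algebraMap R L a' = φ (algebraMap R L a) ∧
      IsLocalRing.residue R a' = IsLocalRing.residue R a ^ q)
    {ϖ : R} (hϖ : Irreducible ϖ) {π : F} (hπ : algebraMap F L π = algebraMap R L ϖ) :
    ∀ Q : (X.baseChange L).toAffine.Point,
      (∀ σ : L ≃ₐ[F] L, σ • Q - Q ∈ (X.baseChange L).goodReductionSubgroup R) →
        ∃ Q' : (X.baseChange L).toAffine.Point, (∀ σ : L ≃ₐ[F] L, σ • Q' = Q') ∧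
          Q - Q' ∈ (X.baseChange L).goodReductionSubgroup R := by
  rcases hasGoodReduction_or_hasMultiplicativeReduction_or_hasAdditiveReduction R
      (W := X.baseChange L) with h | h | h
  · exact absurd h hbad
  · exact hα_of_hasMultiplicativeReduction_of_adicComplete X L R W₀ hX hR φ hφ hn hcard hfrob hϖ hπ
  · exact hα_of_hasAdditiveReduction_of_adicComplete X L R W₀ hX hR φ hφ hn hcard hfrob hϖ hπ

include hX in
/-- **Jetchev's Prop. 4.1 at EVERY BAD place `v`, modulo p1's inputs (a), (b) and the cocycle
ONLY**: `T = ι(t₀ + p^m t₁)` with `t₀ ∈ E₀(K_v)`. (α) and `hstab` of `JetchevKummerAtP` are theorems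
here; `JET@p|N` is NOT discharged. [cite: Jetchev2008, Prop. 4.1 (p. 819)]
[cite: GrossLMS1991, Prop. 6.2 (1), pp. 244–245] [cite: MilneADT2006, Ch. I Prop. 3.8] -/
theorem exists_baseChange_eq_add_pow_smul_of_not_hasGoodReduction_of_adicComplete [IsGalois F L]
    (R₀ : Type*) [CommRing R₀] [IsDomain R₀] [IsDiscreteValuationRing R₀] [Algebra R₀ F]
    [IsFractionRing R₀ F] [Algebra R₀ R] [Algebra R₀ L] [IsScalarTower R₀ R L]
    [IsScalarTower R₀ F L] [IsLocalHom (algebraMap R₀ R)] [(X.baseChange F).IsMinimal R₀]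
    (hbad : ¬ (X.baseChange L).HasGoodReduction R)
    (hR : ∀ (τ : L ≃ₐ[F] L) (x : L), x ∈ Set.range (algebraMap R L) →
      τ x ∈ Set.range (algebraMap R L))
    (φ : L ≃ₐ[F] L) (hφ : ∀ σ : L ≃ₐ[F] L, σ ∈ Subgroup.zpowers φ)
    {q n : ℕ} (hn : φ ^ n = 1) (hcard : Nat.card (IsLocalRing.ResidueField R) = q ^ n)
    (hfrob : ∀ a : R, ∃ a' : R, algebraMap R L a' = φ (algebraMap R L a) ∧
      IsLocalRing.residue R a' = IsLocalRing.residue R a ^ q)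
    {ϖ : R} (hϖ : Irreducible ϖ) {π : F} (hπ : algebraMap F L π = algebraMap R L ϖ)
    {p m n' : ℕ} (hcop : Nat.Coprime n' (p ^ m)) {U P T : (X.baseChange L).toAffine.Point}
    {Rσ : (L ≃ₐ[F] L) → (X.baseChange L).toAffine.Point}
    (hT : ∀ σ : L ≃ₐ[F] L, σ • T = T)
    (hP : (n' : ℤ) • P ∈ (X.baseChange L).goodReductionSubgroup R)
    (hRσ : ∀ σ : L ≃ₐ[F] L, (n' : ℤ) • Rσ σ ∈ (X.baseChange L).goodReductionSubgroup R)
    (hU : ∀ σ : L ≃ₐ[F] L, σ • U - U = Rσ σ) (hpU : ((p ^ m : ℕ) : ℤ) • U = P - T) :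
    ∃ t₀ t₁ : (X.baseChange F).toAffine.Point,
      t₀ ∈ (X.baseChange F).goodReductionSubgroup R₀ ∧
      T = Affine.Point.baseChange (W' := X.toAffine) F L (t₀ + ((p ^ m : ℕ) : ℤ) • t₁) :=
  exists_baseChange_eq_add_pow_smul X L R₀ R
    (fun σ _ hQ ↦ smul_mem_goodReductionSubgroup X L R hR σ hQ)
    (hα_of_not_hasGoodReduction_of_adicComplete X L R W₀ hX hbad hR φ hφ hn hcard hfrob hϖ hπ)
    hcop hT hP hRσ hU hpU

end Bad

/-! ### §5 `E/ℚ` at any BAD prime, in one call -/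

section PadicBad

variable (W : WeierstrassCurve ℚ) [W.IsElliptic] [W.IsGloballyMinimal] (p : ℕ) [Fact p.Prime]
  (L : Type) [Field L] [Algebra ℚ_[p] L]
  (R : Type*) [CommRing R] [IsDomain R] [IsDiscreteValuationRing R] [Algebra R L]
  [IsFractionRing R L] [Algebra ℤ_[p] R] [Algebra ℤ_[p] L] [IsScalarTower ℤ_[p] R L]
  [IsScalarTower ℤ_[p] ℚ_[p] L] [IsLocalHom (algebraMap ℤ_[p] R)]

/-- **(α) for `E/ℚ` at any BAD prime `p` (multiplicative of either sign, or additive), over a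
complete unramified layer `L ⊇ ℚ_p`**, GIVEN `[((W ⊗ ℚ_p) ⊗ L).IsMinimal R]` (a theorem at a
multiplicative `p`, the labelled residual R7′ at an additive one): `by_cases` on
`W.HasMultiplicativeReductionAtPrime p` — p3's `hα_padic_of_hasMultiplicativeReductionAtPrime_of_adicComplete`
or §3. [cite: MilneADT2006, Ch. I Prop. 3.8] -/
theorem hα_padic_of_not_hasGoodReductionAtPrime_of_adicComplete
    [IsAdicComplete (IsLocalRing.maximalIdeal R) R] [Finite (IsLocalRing.ResidueField R)]
    [((W.baseChange ℚ_[p]).baseChange L).IsMinimal R]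
    (hg : ¬ W.HasGoodReductionAtPrime p)
    (W₀ : WeierstrassCurve R) (hX : (W.baseChange ℚ_[p]).baseChange L = W₀.baseChange L)
    (hR : ∀ (τ : L ≃ₐ[ℚ_[p]] L) (x : L), x ∈ Set.range (algebraMap R L) →
      τ x ∈ Set.range (algebraMap R L))
    (φ : L ≃ₐ[ℚ_[p]] L) (hφ : ∀ σ : L ≃ₐ[ℚ_[p]] L, σ ∈ Subgroup.zpowers φ) {q n : ℕ}
    (hn : φ ^ n = 1) (hcard : Nat.card (IsLocalRing.ResidueField R) = q ^ n)
    (hfrob : ∀ a : R, ∃ a' : R, algebraMap R L a' = φ (algebraMap R L a) ∧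
      IsLocalRing.residue R a' = IsLocalRing.residue R a ^ q)
    {ϖ : R} (hϖ : Irreducible ϖ) {π : ℚ_[p]} (hπ : algebraMap ℚ_[p] L π = algebraMap R L ϖ) :
    ∀ Q : ((W.baseChange ℚ_[p]).baseChange L).toAffine.Point,
      (∀ σ : L ≃ₐ[ℚ_[p]] L,
          σ • Q - Q ∈ ((W.baseChange ℚ_[p]).baseChange L).goodReductionSubgroup R) →
        ∃ Q' : ((W.baseChange ℚ_[p]).baseChange L).toAffine.Point,
          (∀ σ : L ≃ₐ[ℚ_[p]] L, σ • Q' = Q') ∧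
            Q - Q' ∈ ((W.baseChange ℚ_[p]).baseChange L).goodReductionSubgroup R := by
  by_cases hm : W.HasMultiplicativeReductionAtPrime p
  · exact hα_padic_of_hasMultiplicativeReductionAtPrime_of_adicComplete W p L R hm W₀ hX hR φ hφ
      hn hcard hfrob hϖ hπ
  · exact hα_padic_of_not_good_of_not_mult_of_adicComplete W p L R hg hm W₀ hX hR φ hφ hn hcard
      hfrob hϖ hπ

/-- **Jetchev's Prop. 4.1 at `v ∣ p`, end form, NO stub, for `E/ℚ` at any BAD prime `p`** — the
single entry point for the (iv) assembly at a bad prime of either type; residual binders =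
`S15-INTERFACE.md` §4 R1–R8 (+ R7′ at an additive prime) and p1's (a), (b), cocycle.
[cite: Jetchev2008, Prop. 4.1 (p. 819)] [cite: MilneADT2006, Ch. I Prop. 3.8]
[cite: GrossLMS1991, Prop. 6.2 (1), pp. 244–245] -/
theorem exists_baseChange_eq_add_pow_smul_padic_of_not_hasGoodReductionAtPrime
    [IsGalois ℚ_[p] L] [IsAdicComplete (IsLocalRing.maximalIdeal R) R]
    [Finite (IsLocalRing.ResidueField R)] [((W.baseChange ℚ_[p]).baseChange L).IsMinimal R]
    [((W.baseChange ℚ_[p]).baseChange ℚ_[p]).IsMinimal ℤ_[p]]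
    (hg : ¬ W.HasGoodReductionAtPrime p)
    (W₀ : WeierstrassCurve R) (hX : (W.baseChange ℚ_[p]).baseChange L = W₀.baseChange L)
    (hR : ∀ (τ : L ≃ₐ[ℚ_[p]] L) (x : L), x ∈ Set.range (algebraMap R L) →
      τ x ∈ Set.range (algebraMap R L))
    (φ : L ≃ₐ[ℚ_[p]] L) (hφ : ∀ σ : L ≃ₐ[ℚ_[p]] L, σ ∈ Subgroup.zpowers φ) {q n : ℕ}
    (hn : φ ^ n = 1) (hcard : Nat.card (IsLocalRing.ResidueField R) = q ^ n)
    (hfrob : ∀ a : R, ∃ a' : R, algebraMap R L a' = φ (algebraMap R L a) ∧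
      IsLocalRing.residue R a' = IsLocalRing.residue R a ^ q)
    {ϖ : R} (hϖ : Irreducible ϖ) {π : ℚ_[p]} (hπ : algebraMap ℚ_[p] L π = algebraMap R L ϖ)
    {m n' : ℕ} (hcop : Nat.Coprime n' (p ^ m))
    {U P T : ((W.baseChange ℚ_[p]).baseChange L).toAffine.Point}
    {Rσ : (L ≃ₐ[ℚ_[p]] L) → ((W.baseChange ℚ_[p]).baseChange L).toAffine.Point}
    (hT : ∀ σ : L ≃ₐ[ℚ_[p]] L, σ • T = T)
    (hP : (n' : ℤ) • P ∈ ((W.baseChange ℚ_[p]).baseChange L).goodReductionSubgroup R)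
    (hRσ : ∀ σ : L ≃ₐ[ℚ_[p]] L,
      (n' : ℤ) • Rσ σ ∈ ((W.baseChange ℚ_[p]).baseChange L).goodReductionSubgroup R)
    (hU : ∀ σ : L ≃ₐ[ℚ_[p]] L, σ • U - U = Rσ σ) (hpU : ((p ^ m : ℕ) : ℤ) • U = P - T) :
    ∃ t₀ t₁ : ((W.baseChange ℚ_[p]).baseChange ℚ_[p]).toAffine.Point,
      t₀ ∈ ((W.baseChange ℚ_[p]).baseChange ℚ_[p]).goodReductionSubgroup ℤ_[p] ∧
      T = Affine.Point.baseChange (W' := (W.baseChange ℚ_[p]).toAffine) ℚ_[p] L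
        (t₀ + ((p ^ m : ℕ) : ℤ) • t₁) := by
  by_cases hm : W.HasMultiplicativeReductionAtPrime p
  · exact exists_baseChange_eq_add_pow_smul_padic_of_hasMultiplicativeReductionAtPrime_of_adicComplete
      W p L R hm W₀ hX hR φ hφ hn hcard hfrob hϖ hπ hcop hT hP hRσ hU hpU
  · exact exists_baseChange_eq_add_pow_smul_padic_of_not_good_of_not_mult W p L R hg hm W₀ hX hR
      φ hφ hn hcard hfrob hϖ hπ hcop hT hP hRσ hU hpU

end PadicBad

end Summit.BirchSwinnertonDyer.Rank1Residual.X11b.Three.JetchevKummer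

end
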